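/-
Summits/MatrixMultiplication/MatrixMultiplication/Theorems/TetraResidualNecessity.lean
decomp-mm lens 6 («barrier-complement carving»), generation 27 — supports item 27058 (TetraPlusTwo,
the declared residual of route TetrahedronCarving).  Part 2/3: the tetrahedron carrier.
-/
import Summits.MatrixMultiplication.MatrixMultiplication.Theorems.TetraResidualNecessityCore

/-!
# Residual necessity: body-semantic carvings of `ω = 2` always contain an ω-bounding piece

## What is certified here (pure convex geometry, no tensor input)

File layout: part 1 `TetraResidualNecessityCore` (worlds, forcing, stability, support-linear
pieces, `residual_necessity` on an abstract carrier); this file = part 2 (the `K₄` carrier: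
flattening points, centroids, facet lemmas, `k4_residual_necessity`,
`k4_residual_necessity_orbit`); part 3 `TetraResidualNecessityInstances` (the dossier pieces
and their stability, the record box, `k4_residual_necessity_box/_flat`, the rectangular
carrier `rect_residual_necessity`).

*World semantics.*  Fix a finite set of generator tensors (for the tetrahedron carrier: the six
EPR legs of `K₄`, coordinates ordered `01,02,12,03,13,23`; for the rectangular carrier: the three
formats `⟨2,1,1⟩,⟨1,2,1⟩,⟨1,1,2⟩`).  Every point `φ` of the asymptotic spectrum gives an exponent
vector `β = (log φ(generator))`, and the exponent of every weighted object `u ≥ 0` is the SUPPORT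
VALUE `sval Δ u = sup_{β ∈ Δ} ⟨u,β⟩` of the body `Δ` of these vectors (Strassen's spectral
theorem: `ω = sval Δ tri`, `ω(K₄) = sval Δ 𝟙`, `ω(2,1,2) = sval Δ (𝟙 - e₀₁)`, …).  A *world* is
any set `Δ` with `Δ₀ ⊆ Δ ⊆ K`: `Δ₀` = mandatory points (the flattening / grouping points, which
lie in the body whatever `ω` is), `K` = the pointwise lawful region (box, record bounds, the
Coppersmith value `α`).  A *piece* is a predicate on worlds; a family FORCES the summit piece
`Cap tri 2 : sval Δ tri ≤ 2` if every world satisfying the family satisfies it (`Forces`).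
Sublinearity, monotonicity and convexity of `u ↦ sval Δ u` hold in EVERY world, so every cut of
the TetrahedronCarving dossier (DefectCone/DefectCuts: convexity `ρ ≤ κ d` + `α > 0.17` + the
two pieces) is a forcing in this sense once its pieces are written over the generators.

*Theorems.*
* `not_forces_of_stable` / `exists_unstable_of_forces` (abstract): pieces that survive adjoining
  the finite perturbation set `C ε` to `Δ₀` for all small `ε > 0` (`StableAlong`) never force a
  piece failing on those worlds; a forcing family has an UNSTABLE member.
* `LinData.stable_of_slack` (support-linear pieces `∑ j, coef_j · sval Δ u_j ≤ rhs`): such a piece,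
  true at `Δ₀`, is stable along the perturbations `x_k + ε v_k` unless it has a term with
  `coef_j > 0`, `⟨u_j,v_k⟩ > 0` and `u_j` TIGHT at `x_k` (`sval Δ₀ u_j ≤ ⟨u_j,x_k⟩`).
* `residual_necessity` (abstract carrier), `k4_residual_necessity` (one exotic point
  `x₀ + ε·tri`, `x₀ = (2/3,2/3,2/3,1/2,1/2,1/2)` = centroid of the six summit-face flattening
  points) and `k4_residual_necessity_orbit` (the `Aut K₄`-symmetric world with the four exotic
  points `x_v + ε·tri_v`): every finite family of support-linear pieces, each true at `Δ₀`, that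
  forces `ω ≤ 2` contains a piece in which `ω` (= `sval` of a positive multiple of a triangle)
  occurs with a POSITIVE coefficient and is TIGHT at `ω = 2` — an ω-upper-bounding piece, i.e. a
  member of the residual class (`TetraPlusTwo : ω + 2 ≤ ω(K₄)`, the pencil `4 + c(ω-2) ≤ ω(K₄)`).
  ω-free pieces (`TetraExcessZero`, `TetraFlat`, `HalfAlpha`, `TetraSixthLeFifth`, rung
  certificates, `B_0`) are stable (`tetraExcessZero_stable`, `residualPencil_zero_stable`) and no
  conjunction of them closes the summit (`omegaFree_not_forces_k4`).
* `rect_residual_necessity`: the same on the rectangular carrier (`x₀ = (2/3,2/3,2/3)`): the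
  «exotic apex» world, promoted from "kills the listed residuals" to "kills every ω-free family".

## Reading for the route (memo NODE-g27)
The cut of record `closes (hA : TetraExcessZero) (hB : TetraPlusTwo)` has the optimal shape
inside body semantics: ONE ω-free attacked piece + ONE ω-bounding residual; the residual cannot
be dissolved by adding ω-free `K₄`/cone/sesqui statements, its only freedom is the slope of the
ω-term (the DefectCuts pencil).  Residual-free decompositions of `ω = 2` need non-body input.
-/

open Filter Topology Set

namespace Summit.MatrixMultiplication.MatrixMultiplication.Theorems.TetraResidualNecessity

/-! ### 3. The tetrahedron carrier `K₄` (coordinates `01,02,12,03,13,23`) -/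

section K4

/-- the triangle `{0,1,2}` = the matrix-multiplication direction: `sval Δ k4tri = ω` -/
def k4tri : Fin 6 → ℝ := ![1, 1, 1, 0, 0, 0]
/-- the other three triangles (vertex `0`, `1`, `2` deleted) -/
def k4tri0 : Fin 6 → ℝ := ![0, 0, 1, 0, 1, 1]
/-- the triangle with vertex `1` deleted: edges `02,03,23` -/
def k4tri1 : Fin 6 → ℝ := ![0, 1, 0, 1, 0, 1]
/-- the triangle with vertex `2` deleted: edges `01,03,13` -/
def k4tri2 : Fin 6 → ℝ := ![1, 0, 0, 1, 1, 0]
/-- all six legs: `sval Δ k4one = ω(K₄)` -/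
def k4one : Fin 6 → ℝ := ![1, 1, 1, 1, 1, 1]
/-- the diamond `K₄ - 01`: `sval Δ k4dia = ω(2,1,2)` -/
def k4dia : Fin 6 → ℝ := ![0, 1, 1, 1, 1, 1]
/-- 1|3 flattening points (stars) at the vertices `0,1,2,3` -/
def k4s0 : Fin 6 → ℝ := ![1, 1, 0, 1, 0, 0]
/-- the star (1|3 flattening point) at vertex `1` -/
def k4s1 : Fin 6 → ℝ := ![1, 0, 1, 0, 1, 0]
/-- the star (1|3 flattening point) at vertex `2` -/
def k4s2 : Fin 6 → ℝ := ![0, 1, 1, 0, 0, 1]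
/-- the star (1|3 flattening point) at vertex `3` -/
def k4s3 : Fin 6 → ℝ := ![0, 0, 0, 1, 1, 1]
/-- 2|2 flattening points for the cuts `01|23`, `02|13`, `03|12` -/
def k4f1 : Fin 6 → ℝ := ![0, 1, 1, 1, 1, 0]
/-- the 2|2 flattening point of the cut `02|13` -/
def k4f2 : Fin 6 → ℝ := ![1, 0, 1, 1, 0, 1]
/-- the 2|2 flattening point of the cut `03|12` -/
def k4f3 : Fin 6 → ℝ := ![1, 1, 0, 0, 1, 1]
/-- centroid of the six flattening points on the summit face `⟨tri,·⟩ = 2`, and its images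
on the faces of the other three triangles -/
noncomputable def k4x0 : Fin 6 → ℝ := ![2/3, 2/3, 2/3, 1/2, 1/2, 1/2]
/-- centroid of the six flattening points on the face of the triangle `k4tri0` -/
noncomputable def k4x0v0 : Fin 6 → ℝ := ![1/2, 1/2, 2/3, 1/2, 2/3, 2/3]
/-- centroid of the six flattening points on the face of the triangle `k4tri1` -/
noncomputable def k4x0v1 : Fin 6 → ℝ := ![1/2, 2/3, 1/2, 2/3, 1/2, 2/3]
/-- centroid of the six flattening points on the face of the triangle `k4tri2` -/
noncomputable def k4x0v2 : Fin 6 → ℝ := ![2/3, 1/2, 1/2, 2/3, 2/3, 1/2]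

/-- the six summit-face flattening points, and all seven flattening points -/
def k4face : List (Fin 6 → ℝ) := [k4s0, k4s1, k4s2, k4f1, k4f2, k4f3]
/-- all seven flattening points of `K₄` (four stars, three 2|2 cuts) -/
def k4flat : List (Fin 6 → ℝ) := [k4s0, k4s1, k4s2, k4s3, k4f1, k4f2, k4f3]

/-- the summit-face points are flattening points -/
theorem k4face_sub_flat : ∀ q ∈ k4face, q ∈ k4flat := by
  intro q hq
  simp only [k4face, k4flat, List.mem_cons, List.mem_nil_iff, or_false] at hq ⊢
  rcases hq with h | h | h | h | h | h <;> simp [h]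

/-- the pairing on `Fin 6` written out -/
theorem dot6 (u β : Fin 6 → ℝ) :
    dot u β = u 0 * β 0 + u 1 * β 1 + u 2 * β 2 + u 3 * β 3 + u 4 * β 4 + u 5 * β 5 := by
  simp [dot, Fin.sum_univ_six]

/-- the centroid lies on the summit face: `⟨tri,x₀⟩ = 2` -/
theorem dot_k4tri_x0 : dot k4tri k4x0 = 2 := by
  rw [dot6]; simp [k4tri, k4x0]; norm_num

/-- `⟨tri,tri⟩ = 3 > 0`: the perturbation `x₀ + ε·tri` raises `ω` -/
theorem dot_k4tri_tri : dot k4tri k4tri = 3 := by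
  rw [dot6]; simp [k4tri]; norm_num

/-- the centroid identities: `6 ⟨u,x_v⟩ = Σ_{q ∈ face_v} ⟨u,q⟩` -/
theorem dot_k4x0_eq (u : Fin 6 → ℝ) :
    6 * dot u k4x0 = dot u k4s0 + dot u k4s1 + dot u k4s2 + dot u k4f1 + dot u k4f2 + dot u k4f3 := by
  simp only [dot6, k4x0, k4s0, k4s1, k4s2, k4f1, k4f2, k4f3]
  simp
  ring

/-- centroid identity for the triangle `k4tri0` -/
theorem dot_k4x0v0_eq (u : Fin 6 → ℝ) :
    6 * dot u k4x0v0 = dot u k4s1 + dot u k4s2 + dot u k4s3 + dot u k4f1 + dot u k4f2 + dot u k4f3 := by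
  simp only [dot6, k4x0v0, k4s1, k4s2, k4s3, k4f1, k4f2, k4f3]
  simp
  ring

/-- centroid identity for the triangle `k4tri1` -/
theorem dot_k4x0v1_eq (u : Fin 6 → ℝ) :
    6 * dot u k4x0v1 = dot u k4s0 + dot u k4s2 + dot u k4s3 + dot u k4f1 + dot u k4f2 + dot u k4f3 := by
  simp only [dot6, k4x0v1, k4s0, k4s2, k4s3, k4f1, k4f2, k4f3]
  simp
  ring

/-- centroid identity for the triangle `k4tri2` -/
theorem dot_k4x0v2_eq (u : Fin 6 → ℝ) :
    6 * dot u k4x0v2 = dot u k4s0 + dot u k4s1 + dot u k4s3 + dot u k4f1 + dot u k4f2 + dot u k4f3 := by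
  simp only [dot6, k4x0v2, k4s0, k4s1, k4s3, k4f1, k4f2, k4f3]
  simp
  ring

/-- `x₀` is dominated by any tame set containing the six face points -/
theorem k4x0_dominated {Δ₀ : Set (Fin 6 → ℝ)} (hΔ : Tame Δ₀) (hface : ∀ q ∈ k4face, q ∈ Δ₀)
    (u : Fin 6 → ℝ) : dot u k4x0 ≤ sval Δ₀ u := by
  have h0 := le_sval hΔ u (hface k4s0 (by simp [k4face]))
  have h1 := le_sval hΔ u (hface k4s1 (by simp [k4face]))
  have h2 := le_sval hΔ u (hface k4s2 (by simp [k4face]))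
  have h4 := le_sval hΔ u (hface k4f1 (by simp [k4face]))
  have h5 := le_sval hΔ u (hface k4f2 (by simp [k4face]))
  have h6 := le_sval hΔ u (hface k4f3 (by simp [k4face]))
  have := dot_k4x0_eq u
  linarith

/-- all four centroids are dominated by any tame set containing the seven flattening points -/
theorem k4x0v_dominated {Δ₀ : Set (Fin 6 → ℝ)} (hΔ : Tame Δ₀) (hflat : ∀ q ∈ k4flat, q ∈ Δ₀)
    (u : Fin 6 → ℝ) :
    dot u k4x0 ≤ sval Δ₀ u ∧ dot u k4x0v0 ≤ sval Δ₀ u ∧ dot u k4x0v1 ≤ sval Δ₀ u ∧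
      dot u k4x0v2 ≤ sval Δ₀ u := by
  have h0 := le_sval hΔ u (hflat k4s0 (by simp [k4flat]))
  have h1 := le_sval hΔ u (hflat k4s1 (by simp [k4flat]))
  have h2 := le_sval hΔ u (hflat k4s2 (by simp [k4flat]))
  have h3 := le_sval hΔ u (hflat k4s3 (by simp [k4flat]))
  have h4 := le_sval hΔ u (hflat k4f1 (by simp [k4flat]))
  have h5 := le_sval hΔ u (hflat k4f2 (by simp [k4flat]))
  have h6 := le_sval hΔ u (hflat k4f3 (by simp [k4flat]))
  have e := dot_k4x0_eq u
  have e0 := dot_k4x0v0_eq u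
  have e1 := dot_k4x0v1_eq u
  have e2 := dot_k4x0v2_eq u
  refine ⟨by linarith, by linarith, by linarith, by linarith⟩

/-- **Facet lemma for `K₄`.**  A direction bounded by `M` on the six face points and reaching
`M` at their centroid is a multiple of the triangle: `u = μ • tri`, `M = 2μ`. -/
theorem k4_facet (u : Fin 6 → ℝ) (M : ℝ)
    (h0 : dot u k4s0 ≤ M) (h1 : dot u k4s1 ≤ M) (h2 : dot u k4s2 ≤ M)
    (h4 : dot u k4f1 ≤ M) (h5 : dot u k4f2 ≤ M) (h6 : dot u k4f3 ≤ M)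
    (hx : M ≤ dot u k4x0) :
    u = (u 0) • k4tri ∧ M = 2 * u 0 := by
  have hc := dot_k4x0_eq u
  simp only [dot6, k4s0, k4s1, k4s2, k4f1, k4f2, k4f3, k4x0] at h0 h1 h2 h4 h5 h6 hc hx
  simp at h0 h1 h2 h4 h5 h6 hc hx
  have e3 : u 3 = 0 := by linarith
  have e4 : u 4 = 0 := by linarith
  have e5 : u 5 = 0 := by linarith
  have e1 : u 1 = u 0 := by linarith
  have e2 : u 2 = u 0 := by linarith
  refine ⟨?_, by linarith⟩
  funext i
  fin_cases i <;> simp [k4tri, e1, e2, e3, e4, e5]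

/-- the facet lemmas for the other three triangles -/
theorem k4_facet0 (u : Fin 6 → ℝ) (M : ℝ)
    (h1 : dot u k4s1 ≤ M) (h2 : dot u k4s2 ≤ M) (h3 : dot u k4s3 ≤ M)
    (h4 : dot u k4f1 ≤ M) (h5 : dot u k4f2 ≤ M) (h6 : dot u k4f3 ≤ M)
    (hx : M ≤ dot u k4x0v0) :
    u = (u 2) • k4tri0 ∧ M = 2 * u 2 := by
  have hc := dot_k4x0v0_eq u
  simp only [dot6, k4s1, k4s2, k4s3, k4f1, k4f2, k4f3, k4x0v0] at h1 h2 h3 h4 h5 h6 hc hx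
  simp at h1 h2 h3 h4 h5 h6 hc hx
  have e0 : u 0 = 0 := by linarith
  have e1 : u 1 = 0 := by linarith
  have e3 : u 3 = 0 := by linarith
  have e4 : u 4 = u 2 := by linarith
  have e5 : u 5 = u 2 := by linarith
  refine ⟨?_, by linarith⟩
  funext i
  fin_cases i <;> simp [k4tri0, e0, e1, e3, e4, e5]

/-- facet lemma for the triangle `k4tri1` -/
theorem k4_facet1 (u : Fin 6 → ℝ) (M : ℝ)
    (h0 : dot u k4s0 ≤ M) (h2 : dot u k4s2 ≤ M) (h3 : dot u k4s3 ≤ M)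
    (h4 : dot u k4f1 ≤ M) (h5 : dot u k4f2 ≤ M) (h6 : dot u k4f3 ≤ M)
    (hx : M ≤ dot u k4x0v1) :
    u = (u 1) • k4tri1 ∧ M = 2 * u 1 := by
  have hc := dot_k4x0v1_eq u
  simp only [dot6, k4s0, k4s2, k4s3, k4f1, k4f2, k4f3, k4x0v1] at h0 h2 h3 h4 h5 h6 hc hx
  simp at h0 h2 h3 h4 h5 h6 hc hx
  have e0 : u 0 = 0 := by linarith
  have e2 : u 2 = 0 := by linarith
  have e4 : u 4 = 0 := by linarith
  have e3 : u 3 = u 1 := by linarith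
  have e5 : u 5 = u 1 := by linarith
  refine ⟨?_, by linarith⟩
  funext i
  fin_cases i <;> simp [k4tri1, e0, e2, e3, e4, e5]

/-- facet lemma for the triangle `k4tri2` -/
theorem k4_facet2 (u : Fin 6 → ℝ) (M : ℝ)
    (h0 : dot u k4s0 ≤ M) (h1 : dot u k4s1 ≤ M) (h3 : dot u k4s3 ≤ M)
    (h4 : dot u k4f1 ≤ M) (h5 : dot u k4f2 ≤ M) (h6 : dot u k4f3 ≤ M)
    (hx : M ≤ dot u k4x0v2) :
    u = (u 0) • k4tri2 ∧ M = 2 * u 0 := by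
  have hc := dot_k4x0v2_eq u
  simp only [dot6, k4s0, k4s1, k4s3, k4f1, k4f2, k4f3, k4x0v2] at h0 h1 h3 h4 h5 h6 hc hx
  simp at h0 h1 h3 h4 h5 h6 hc hx
  have e1 : u 1 = 0 := by linarith
  have e2 : u 2 = 0 := by linarith
  have e5 : u 5 = 0 := by linarith
  have e3 : u 3 = u 0 := by linarith
  have e4 : u 4 = u 0 := by linarith
  refine ⟨?_, by linarith⟩
  funext i
  fin_cases i <;> simp [k4tri2, e1, e2, e3, e4, e5]

/-- the one-point perturbation `x₀ + ε·tri` and the `Aut K₄`-orbit perturbation -/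
noncomputable def k4pert : List ((Fin 6 → ℝ) × (Fin 6 → ℝ)) := [(k4x0, k4tri)]
/-- the `Aut K₄`-orbit perturbation: the four exotic points `x_v + ε·tri_v` -/
noncomputable def k4pertOrbit : List ((Fin 6 → ℝ) × (Fin 6 → ℝ)) :=
  [(k4x0, k4tri), (k4x0v0, k4tri0), (k4x0v1, k4tri1), (k4x0v2, k4tri2)]

/-- **Residual necessity on the tetrahedron carrier (one exotic point).**  Let `Δ₀` (tame,
inside the lawful region `K`) contain the six summit-face flattening points, and let `K`
leave room along `x₀ + ε·tri`.  If a finite family of support-linear pieces, each true at `Δ₀`,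
forces `ω ≤ 2` (`Cap k4tri 2`), then one of the pieces contains a term `coef · sval Δ (μ • tri)`
with `coef > 0`, `μ > 0`, tight at `Δ₀` (`sval Δ₀ (μ • tri) = 2μ`): an ω-upper-bounding piece
tight at `ω = 2` — the residual class. -/
theorem k4_residual_necessity {Δ₀ K : Set (Fin 6 → ℝ)} (hΔ : Tame Δ₀) (hK : Δ₀ ⊆ K)
    (hface : ∀ q ∈ k4face, q ∈ Δ₀)
    (hroom : ∀ᶠ ε in 𝓝[>] (0 : ℝ), k4x0 + ε • k4tri ∈ K)
    (Ps : List (LinData (Fin 6))) (hnec : ∀ D ∈ Ps, D.holds Δ₀)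
    (hF : Forces Δ₀ K (Ps.map LinData.holds) (Cap k4tri 2)) :
    ∃ D ∈ Ps, ∃ j, ∃ μ : ℝ, 0 < D.coef j ∧ 0 < μ ∧ D.dir j = μ • k4tri ∧
      sval Δ₀ (D.dir j) = 2 * μ := by
  have hroom' : ∀ xv ∈ k4pert, ∀ᶠ ε in 𝓝[>] (0 : ℝ), xv.1 + ε • xv.2 ∈ K := by
    intro xv hxv
    simp only [k4pert, List.mem_singleton] at hxv
    subst hxv
    exact hroom
  have hx : ∀ xv ∈ k4pert, ∀ u, dot u xv.1 ≤ sval Δ₀ u := by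
    intro xv hxv u
    simp only [k4pert, List.mem_singleton] at hxv
    subst hxv
    exact k4x0_dominated hΔ hface u
  obtain ⟨D, hD, xv, hxv, j, hj, hjv, htight⟩ :=
    residual_necessity hΔ hK k4pert hroom' hx (xv₀ := (k4x0, k4tri)) (by simp [k4pert])
      dot_k4tri_x0 (by rw [dot_k4tri_tri]; norm_num) Ps hnec hF
  simp only [k4pert, List.mem_singleton] at hxv
  subst hxv
  have hb := fun q hq => le_sval hΔ (D.dir j) (hface q hq)
  obtain ⟨hdir, hM⟩ := k4_facet (D.dir j) (sval Δ₀ (D.dir j))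
    (hb k4s0 (by simp [k4face])) (hb k4s1 (by simp [k4face])) (hb k4s2 (by simp [k4face]))
    (hb k4f1 (by simp [k4face])) (hb k4f2 (by simp [k4face])) (hb k4f3 (by simp [k4face])) htight
  refine ⟨D, hD, j, D.dir j 0, hj, ?_, hdir, hM⟩
  have : dot (D.dir j) k4tri = D.dir j 0 * 3 := by
    rw [hdir, dot_smul_left, dot_k4tri_tri]
    simp [k4tri]
  nlinarith [hjv, this]

/-- **Residual necessity on the tetrahedron carrier, `Aut K₄`-symmetric world.**  With all seven
flattening points mandatory and room along all four exotic directions `x_v + ε·tri_v` (the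
perturbed world is then `Aut K₄`-invariant whenever `Δ₀` is), every finite family of
support-linear pieces, each true at `Δ₀`, forcing `ω ≤ 2` contains a piece with a positive term
`coef · sval Δ (μ • tri_v)`, `μ > 0`, tight (`= 2μ`) — an ω-term for one of the four triangles. -/
theorem k4_residual_necessity_orbit {Δ₀ K : Set (Fin 6 → ℝ)} (hΔ : Tame Δ₀) (hK : Δ₀ ⊆ K)
    (hflat : ∀ q ∈ k4flat, q ∈ Δ₀)
    (hroom : ∀ xv ∈ k4pertOrbit, ∀ᶠ ε in 𝓝[>] (0 : ℝ), xv.1 + ε • xv.2 ∈ K)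
    (Ps : List (LinData (Fin 6))) (hnec : ∀ D ∈ Ps, D.holds Δ₀)
    (hF : Forces Δ₀ K (Ps.map LinData.holds) (Cap k4tri 2)) :
    ∃ D ∈ Ps, ∃ j, ∃ μ : ℝ, 0 < D.coef j ∧ 0 < μ ∧ sval Δ₀ (D.dir j) = 2 * μ ∧
      (D.dir j = μ • k4tri ∨ D.dir j = μ • k4tri0 ∨ D.dir j = μ • k4tri1 ∨
        D.dir j = μ • k4tri2) := by
  have hx : ∀ xv ∈ k4pertOrbit, ∀ u, dot u xv.1 ≤ sval Δ₀ u := by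
    intro xv hxv u
    have hd := k4x0v_dominated hΔ hflat u
    simp only [k4pertOrbit, List.mem_cons, List.mem_nil_iff, or_false] at hxv
    rcases hxv with rfl | rfl | rfl | rfl
    · exact hd.1
    · exact hd.2.1
    · exact hd.2.2.1
    · exact hd.2.2.2
  obtain ⟨D, hD, xv, hxv, j, hj, hjv, htight⟩ :=
    residual_necessity hΔ hK k4pertOrbit hroom hx (xv₀ := (k4x0, k4tri)) (by simp [k4pertOrbit])
      dot_k4tri_x0 (by rw [dot_k4tri_tri]; norm_num) Ps hnec hF
  have hb := fun q hq => le_sval hΔ (D.dir j) (hflat q hq)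
  have b0 := hb k4s0 (by simp [k4flat])
  have b1 := hb k4s1 (by simp [k4flat])
  have b2 := hb k4s2 (by simp [k4flat])
  have b3 := hb k4s3 (by simp [k4flat])
  have b4 := hb k4f1 (by simp [k4flat])
  have b5 := hb k4f2 (by simp [k4flat])
  have b6 := hb k4f3 (by simp [k4flat])
  simp only [k4pertOrbit, List.mem_cons, List.mem_nil_iff, or_false] at hxv
  rcases hxv with rfl | rfl | rfl | rfl
  · obtain ⟨hdir, hM⟩ := k4_facet (D.dir j) _ b0 b1 b2 b4 b5 b6 htight
    refine ⟨D, hD, j, D.dir j 0, hj, ?_, hM, Or.inl hdir⟩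
    have : dot (D.dir j) k4tri = D.dir j 0 * 3 := by
      rw [hdir, dot_smul_left, dot_k4tri_tri]; simp [k4tri]
    simp only at hjv
    nlinarith [hjv, this]
  · obtain ⟨hdir, hM⟩ := k4_facet0 (D.dir j) _ b1 b2 b3 b4 b5 b6 htight
    refine ⟨D, hD, j, D.dir j 2, hj, ?_, hM, Or.inr (Or.inl hdir)⟩
    have e : dot k4tri0 k4tri0 = 3 := by rw [dot6]; simp [k4tri0]; norm_num
    have : dot (D.dir j) k4tri0 = D.dir j 2 * 3 := by
      rw [hdir, dot_smul_left, e]; simp [k4tri0]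
    simp only at hjv
    nlinarith [hjv, this]
  · obtain ⟨hdir, hM⟩ := k4_facet1 (D.dir j) _ b0 b2 b3 b4 b5 b6 htight
    refine ⟨D, hD, j, D.dir j 1, hj, ?_, hM, Or.inr (Or.inr (Or.inl hdir))⟩
    have e : dot k4tri1 k4tri1 = 3 := by rw [dot6]; simp [k4tri1]; norm_num
    have : dot (D.dir j) k4tri1 = D.dir j 1 * 3 := by
      rw [hdir, dot_smul_left, e]; simp [k4tri1]
    simp only at hjv
    nlinarith [hjv, this]
  · obtain ⟨hdir, hM⟩ := k4_facet2 (D.dir j) _ b0 b1 b3 b4 b5 b6 htight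
    refine ⟨D, hD, j, D.dir j 0, hj, ?_, hM, Or.inr (Or.inr (Or.inr hdir))⟩
    have e : dot k4tri2 k4tri2 = 3 := by rw [dot6]; simp [k4tri2]; norm_num
    have : dot (D.dir j) k4tri2 = D.dir j 0 * 3 := by
      rw [hdir, dot_smul_left, e]; simp [k4tri2]
    simp only at hjv
    nlinarith [hjv, this]

end K4

end Summit.MatrixMultiplication.MatrixMultiplication.Theorems.TetraResidualNecessity
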